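/-
Copyright (c) 2026 the pub-hodgecm-mathlib formalisation cell (harness21).  Prover seat hodgecm-mathlib-F0P3a-p06 (g27); E1 keeper ∕ dealer
F0P3a-p03 (g31) (E1 ledger row 79 «(SEP) LINE-JACQUET BLOCK SEPARATION», EXT-ROAD v2; §0 = (SEP-T), keeper k110); 2026-09-03.
-/
import Literature.NumberTheory.Automorphic.IntertwiningMapTransport   -- ★ p853067: `exists_normalizedJacquet_shortExact`; brings ★ FN `frobeniusNormalized_symm_comp`, ★ `frobeniusEquiv`, ★ `normalizedJacquetHomEquiv`, ★ `jacquetMap_*`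
import HarnessLib

/-!
# Block separation through an ISOTYPIC Jacquet module: a smooth extension `0 → W → E → V → 0` whose quotient has `θ`-isotypic
# normalised Jacquet module SPLITS, unless `E` itself embeds in the principal series `i_P(σ)` realising `W` (`σ` `χ`-isotypic, `χ ≠ θ`)
# (Bernstein–Zelevinsky 1977 §1.9, §2.3; Casselman 1995 §3.2, §6.3)

Topic `NumberTheory/Automorphic`; namespace `Representation` (dot-notation neighbourhood of ★ `Representation.normalizedJacquet`,
★ `Representation.normalizedInd`).  THEOREMS ONLY (no definition, no instance, no notation, no named fact).  Cell `pub/hodgecm-mathlib`,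
crux H413 = `stmt-HodgeConjecture-24833` (`--supports` lane): E1 row 79 of EXT-ROAD v2 (census LH6-p04 (g12) 85875cce ∕ second reading
F0P3a-p06 (g27) 4d08d059, keeper F0P3a-p03 (g31) k106∕k110) — the «no Bernstein centre» block separation that the NOT-WILD road for
[Rogawski1990, Prop. 12.6.1 (b)] outside the EP family consumes: in rank one, two irreducible constituents of DIFFERENT principal series have
no non-split extension, and the proof needs only Frobenius reciprocity, exactness of the Jacquet functor and ONE separating torus element.

THE MATHEMATICS.  Let `t = (P, M, N)` be a parabolic triple of `G` with `δ_P|_N = 1`, `N` a union of compact open subgroups and `M`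
COMMUTATIVE (a minimal parabolic of a quasi-split rank-one group: `M` a torus).  Let `0 → W →ⁱ E →ᵖ V → 0` be an exact sequence of
representations with `W, E` smooth, `V` irreducible (no `G`-stable subspace other than `⊥, ⊤`), and suppose
* the normalised Jacquet module `r_P(V)` is `θ`-ISOTYPIC (`M` acts by the character `θ`; e.g. `r_P(V) ≅ ℂ_θ` a line — the labelled constituents
  `π²(ξ), πⁿ(ξ)`, the l.d.s. members, `St`, `ψ∘det` of `U(3)`),
* `W` EMBEDS in `i_P(σ)` for a `χ`-ISOTYPIC `σ` (`ι : W ↪ normalizedInd t σ`; e.g. `σ = ℂ_χ`), with `χ ≠ θ`.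
THEN either `p` has a `G`-equivariant section (the extension SPLITS), or there is an INJECTIVE `G`-map `Φ : E ↪ i_P(σ)` extending `ι`
(so `V ≅ E∕W` is a subquotient of `i_P(σ)` — in the consumer's words, a constituent of the series realising `W`).
PROOF.  §0 (SEP-T, pure algebra): a `G`-map `a : X₁ → Y` into a `χ`-isotypic `Y` extends along an injective `G`-map `j : X₁ → X` with
`θ`-isotypic cokernel as soon as ONE `g₀` commuting with the action has `χ g₀ ≠ θ g₀` — explicitly `b := (χ g₀ − θ g₀)⁻¹ • a ∘ j⁻¹ ∘ (ρ g₀ − θ g₀)`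
(the operator `ρ g₀ − θ g₀` lands in `j(X₁)` because the cokernel is `θ`-isotypic).  §1: `r_P` is exact on the sequence (★ `exists_normalizedJacquet_shortExact`),
so `r_P(E) ⊇ r_P(W)` has `θ`-isotypic cokernel `r_P(V)`; the Frobenius image `a = E_W(ι) : r_P(W) → σ` (★ `frobeniusEquiv` ∘ ★ `normalizedJacquetHomEquiv`)
extends by §0 to `b : r_P(E) → σ` (`M` commutative supplies the commuting `g₀`); Frobenius back gives `Φ := E_E⁻¹(b) : E → i_P(σ)` with `Φ ∘ i = ι`
(★ FN `frobeniusNormalized_symm_comp`, naturality in the `G`-variable).  Since `ι` is injective, `ker Φ ⊓ i(W) = ⊥`; if `ker Φ = ⊥` we are in the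
second alternative; otherwise `p|_{ker Φ}` is injective (`ker p = i(W)`) with non-zero `G`-stable image in the irreducible `V`, hence bijective onto
`V`, and `i_{ker Φ} ∘ (p|_{ker Φ})⁻¹` is a `G`-section of `p`.

* §0 `exists_intertwiningMap_comp_eq_of_isotypic_quotient` (SEP-T; any field `k`, any monoid `G`; dimension-free, eigenspace-free).
* §1 **`exists_section_or_exists_injective_of_isotypic_normalizedJacquet`** (SEP).

HONEST LABEL: count-neutral generic helper (E1 = PRINT; the (b)-REST ride exists only on the LEAD's price of EXT-ROAD v2); h413 OPEN; HC_CM is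
proved only modulo the 7 printed citations (2 remaining named inputs hLiu418 = stmt-HodgeConjecture-24832, h413 = stmt-HodgeConjecture-24833)
until rung 0 closes.

## References
* [BernsteinZelevinsky1977] I. N. Bernstein, A. V. Zelevinsky, *Induced representations of reductive p-adic groups I*, Ann. Sci. ÉNS 10 (1977),
  §1.9 Prop. 1.9 (a) (exactness of `r_{U,θ}`), (b) (Frobenius reciprocity), §2.3 (normalisation), §2.1–2.3 (constituents and Jacquet modules).
* [Casselman1995] W. Casselman, *Introduction to the theory of admissible representations of p-adic reductive groups* (1995), §3.2 Thm. 3.2.3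
  (exactness), Thm. 3.2.4 (Frobenius reciprocity), §6.3 (constituents of principal series; Cor. 6.3.9).
-/

set_option autoImplicit false

noncomputable section

namespace Representation

open Function Literature.NumberTheory.Automorphic

/-! ## §0 (SEP-T) Extending a `G`-map across an isotypic cokernel into an isotypic target, one commuting element separating the two characters -/

section SepT

variable {k G : Type*} [Field k] [Monoid G]
  {X₁ X Y : Type*} [AddCommGroup X₁] [Module k X₁] [AddCommGroup X] [Module k X] [AddCommGroup Y] [Module k Y]
  (ρ₁ : Representation k G X₁) (ρ : Representation k G X) (τ : Representation k G Y)

/-- **(SEP-T)** Let `j : X₁ → X` be an injective `G`-map whose cokernel is `θ`-ISOTYPIC (`G` acts on `X ∕ j(X₁)` by the character `θ`), let the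
target `τ` be `χ`-ISOTYPIC, and suppose ONE element `g₀` with `χ g₀ ≠ θ g₀` acts on `X` commuting with every `ρ g`.  Then every `G`-map
`a : X₁ → Y` extends along `j`: explicitly `b := (χ g₀ − θ g₀)⁻¹ • a ∘ j⁻¹ ∘ (ρ g₀ − θ g₀)` (the operator `ρ g₀ − θ g₀` maps `X` into `j(X₁)`).
No finiteness, no eigenspace decomposition: the elementary core of «`Ext¹_M(θ, χ) = 0` for distinct characters of a commutative `M`».
[cite: BernsteinZelevinsky1977, §2.1–2.3] [cite: Casselman1995, §6.3] -/
theorem exists_intertwiningMap_comp_eq_of_isotypic_quotient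
    (j : IntertwiningMap ρ₁ ρ) (hj : Injective j)
    (χ θ : G →* kˣ) (hθ : ∀ g x, ρ g x - ((θ g : kˣ) : k) • x ∈ LinearMap.range j.toLinearMap)
    (hχ : ∀ g y, τ g y = ((χ g : kˣ) : k) • y)
    (g₀ : G) (hg₀ : χ g₀ ≠ θ g₀) (hcomm : ∀ g, ρ g * ρ g₀ = ρ g₀ * ρ g)
    (a : IntertwiningMap ρ₁ τ) :
    ∃ b : IntertwiningMap ρ τ, b.toLinearMap ∘ₗ j.toLinearMap = a.toLinearMap := by
  -- the separating scalar
  set c : k := ((χ g₀ : kˣ) : k) - ((θ g₀ : kˣ) : k) with hc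
  have hc0 : c ≠ 0 := by
    intro h
    apply hg₀
    exact Units.ext (sub_eq_zero.1 h)
  -- `A := ρ g₀ − θ g₀` lands in `range j`; `e : X₁ ≃ range j`
  set A : X →ₗ[k] X := ρ g₀ - ((θ g₀ : kˣ) : k) • LinearMap.id with hA
  have hAmem : ∀ x, A x ∈ LinearMap.range j.toLinearMap := fun x => by
    simpa [hA] using hθ g₀ x
  let e : X₁ ≃ₗ[k] LinearMap.range j.toLinearMap := LinearEquiv.ofInjective j.toLinearMap hj
  -- the candidate: `b x = c⁻¹ • a (e⁻¹ (A x))`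
  let A' : X →ₗ[k] LinearMap.range j.toLinearMap := LinearMap.codRestrict _ A hAmem
  let b₀ : X →ₗ[k] Y := c⁻¹ • (a.toLinearMap ∘ₗ (e.symm : LinearMap.range j.toLinearMap →ₗ[k] X₁) ∘ₗ A')
  have he : ∀ x₁ : X₁, (e.symm ⟨j x₁, LinearMap.mem_range_self j.toLinearMap x₁⟩) = x₁ := fun x₁ => by
    apply hj
    have := LinearEquiv.ofInjective_symm_apply (f := j.toLinearMap) (h := hj) ⟨j x₁, LinearMap.mem_range_self j.toLinearMap x₁⟩
    exact this
  have hb₀ : ∀ x, ∀ x₁ : X₁, A x = j x₁ → b₀ x = c⁻¹ • a x₁ := fun x x₁ hx => by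
    have h1 : A' x = ⟨j x₁, LinearMap.mem_range_self j.toLinearMap x₁⟩ := Subtype.ext (by simpa [A'] using hx)
    simp only [b₀, LinearMap.smul_apply, LinearMap.coe_comp, Function.comp_apply, LinearEquiv.coe_coe, h1, he]
    rfl
  refine ⟨⟨b₀, fun g => ?_⟩, ?_⟩
  · -- equivariance: `A (ρ g x) = ρ g (A x) = j (ρ₁ g x₁)` when `A x = j x₁`
    apply LinearMap.ext
    intro x
    obtain ⟨x₁, hx₁⟩ := hAmem x
    have hx₁' : A x = j x₁ := by simpa using hx₁.symm
    have hAg : A (ρ g x) = j (ρ₁ g x₁) := by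
      have hcm : A (ρ g x) = ρ g (A x) := by
        have := congrArg (fun T : X →ₗ[k] X => T x) (hcomm g)
        simp only [Module.End.mul_apply] at this
        simp only [hA, LinearMap.sub_apply, LinearMap.smul_apply, LinearMap.id_apply, map_sub, map_smul, this]
      rw [hcm, hx₁', j.isIntertwining]
    simp only [LinearMap.coe_comp, Function.comp_apply]
    rw [hb₀ (ρ g x) (ρ₁ g x₁) hAg, hb₀ x x₁ hx₁', a.isIntertwining, hχ, hχ, smul_comm]
  · -- `b ∘ j = a`: `A (j x₁) = j (ρ₁ g₀ x₁ − θ g₀ • x₁)` and `a` of that is `c • a x₁`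
    apply LinearMap.ext
    intro x₁
    have hAj : A (j x₁) = j (ρ₁ g₀ x₁ - ((θ g₀ : kˣ) : k) • x₁) := by
      simp only [hA, LinearMap.sub_apply, LinearMap.smul_apply, LinearMap.id_apply, map_sub, map_smul, j.isIntertwining]
    simp only [LinearMap.coe_comp, Function.comp_apply]
    change b₀ (j x₁) = a x₁
    rw [hb₀ (j x₁) _ hAj, map_sub, map_smul, a.isIntertwining, hχ, ← sub_smul, ← hc, smul_smul, inv_mul_cancel₀ hc0, one_smul]

end SepT

/-! ## §1 (SEP) The splitting alternative for a smooth extension with isotypic quotient Jacquet module -/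

section Sep

variable {G : Type*} [Group G] [TopologicalSpace G] [IsTopologicalGroup G]
  (t : ParabolicTriple G) [LocallyCompactSpace t.P]
  {XW XE XV Y : Type*} [AddCommGroup XW] [Module ℂ XW] [AddCommGroup XE] [Module ℂ XE] [AddCommGroup XV] [Module ℂ XV]
  [AddCommGroup Y] [Module ℂ Y]
  {ρW : Representation ℂ G XW} {ρE : Representation ℂ G XE} {ρV : Representation ℂ G XV}

/-- **(SEP) BLOCK SEPARATION THROUGH AN ISOTYPIC JACQUET MODULE.**  Over a parabolic triple `t = (P, M, N)` with `δ_P|_N = 1`, `N` a union of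
compact open subgroups and `M` commutative: for an exact sequence `0 → W →ⁱ E →ᵖ V → 0` with `W, E` smooth and `V` irreducible, whose quotient
has `θ`-ISOTYPIC normalised Jacquet module `r_P(V)`, and an embedding `ι : W ↪ i_P(σ)` into the normalised induction of a `χ`-ISOTYPIC `σ`
with `χ ≠ θ` — EITHER `p` has a `G`-equivariant section (the extension splits) OR `E` embeds `G`-equivariantly in `i_P(σ)` by a map extending `ι`
(so `V = E∕W` is a subquotient of `i_P(σ)`).  Proof: §0 on the exact normalised Jacquet sequence (★ `exists_normalizedJacquet_shortExact`) applied
to the Frobenius image of `ι`, Frobenius naturality back (★ `frobeniusNormalized_symm_comp`), then the kernel dichotomy `ker Φ ⊓ i(W) = ⊥`.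
[cite: BernsteinZelevinsky1977, §1.9 Prop. 1.9 (a)–(b), §2.3] [cite: Casselman1995, §3.2 Thm. 3.2.3–3.2.4, §6.3] -/
theorem exists_section_or_exists_injective_of_isotypic_normalizedJacquet
    (hN : IsLimitOfCompactOpen t.N) (hδ : ∀ (n : G) (hn : n ∈ t.N), deltaChar t.P ⟨n, t.N_le hn⟩ = 1)
    (hcomm : ∀ m m' : t.M, m * m' = m' * m)
    (hW : ρW.IsSmooth) (hE : ρE.IsSmooth)
    (i : ρW.IntertwiningMap ρE) (p : ρE.IntertwiningMap ρV) (hi : Injective i)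
    (hex : LinearMap.ker p.toLinearMap = LinearMap.range i.toLinearMap) (hp : Surjective p)
    (hVirr : ∀ S : Submodule ℂ XV, (∀ g, S ≤ S.comap (ρV g)) → S = ⊥ ∨ S = ⊤)
    (θ : t.M →* ℂˣ) (hθ : ∀ (m : t.M) (x : (t.restrict ρV).Coinvariants), ρV.normalizedJacquet t m x = ((θ m : ℂˣ) : ℂ) • x)
    (σ : Representation ℂ t.M Y) (χ : t.M →* ℂˣ) (hσ : ∀ m y, σ m y = ((χ m : ℂˣ) : ℂ) • y) (hne : χ ≠ θ)
    (ι : ρW.IntertwiningMap (Representation.normalizedInd t σ)) (hι : Injective ι) :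
    (∃ s : ρV.IntertwiningMap ρE, p.comp s = IntertwiningMap.id ρV) ∨
      ∃ Φ : ρE.IntertwiningMap (Representation.normalizedInd t σ), Injective Φ ∧ Φ.comp i = ι := by
  -- (1) the exact normalised Jacquet sequence `0 → r W →F r E →G' r V → 0`
  have hexact : Function.Exact i p := LinearMap.exact_iff.2 hex
  obtain ⟨F, G', hF, -, hFinj, hFG, -⟩ := exists_normalizedJacquet_shortExact t hN hE i p hi hexact hp
  -- (2) the Frobenius image of `ι`
  let EW := (frobeniusEquiv (H := t.P) (σ := Representation.twist (σ.comp t.proj) (rootDeltaChar t.P)) hW).trans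
    (normalizedJacquetHomEquiv t ρW σ hδ)
  let EE := (frobeniusEquiv (H := t.P) (σ := Representation.twist (σ.comp t.proj) (rootDeltaChar t.P)) hE).trans
    (normalizedJacquetHomEquiv t ρE σ hδ)
  let a : (ρW.normalizedJacquet t).IntertwiningMap σ := EW ι
  -- (3) the cokernel of `F` is `θ`-isotypic
  have hθ' : ∀ (m : t.M) (x : (t.restrict ρE).Coinvariants),
      ρE.normalizedJacquet t m x - ((θ m : ℂˣ) : ℂ) • x ∈ LinearMap.range F.toLinearMap := fun m x => by
    have hk : G' (ρE.normalizedJacquet t m x - ((θ m : ℂˣ) : ℂ) • x) = 0 := by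
      rw [map_sub, map_smul, G'.isIntertwining, hθ, sub_self]
    obtain ⟨y, hy⟩ := (hFG _).1 hk
    exact ⟨y, hy⟩
  -- (4) one separating element of the commutative `M`
  obtain ⟨g₀, hg₀⟩ : ∃ g₀ : t.M, χ g₀ ≠ θ g₀ := by
    by_contra h
    exact hne (MonoidHom.ext fun m => by_contra fun hm => h ⟨m, hm⟩)
  have hcomm' : ∀ m : t.M, ρE.normalizedJacquet t m * ρE.normalizedJacquet t g₀ =
      ρE.normalizedJacquet t g₀ * ρE.normalizedJacquet t m := fun m => by
    rw [← map_mul, ← map_mul, hcomm]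
  -- (5) §0: extend `a` along `F`
  obtain ⟨b, hb⟩ := exists_intertwiningMap_comp_eq_of_isotypic_quotient (ρW.normalizedJacquet t) (ρE.normalizedJacquet t) σ
    F hFinj χ θ hθ' hσ g₀ hg₀ hcomm' a
  -- (6) Frobenius back: `Φ := EE⁻¹ b` extends `ι`
  let Φ : ρE.IntertwiningMap (Representation.normalizedInd t σ) := EE.symm b
  have hΦi : Φ.comp i = ι := by
    have hψ : a.toLinearMap = b.toLinearMap ∘ₗ (jacquetMap t i).toLinearMap := by rw [← hF, hb]
    have h := frobeniusNormalized_symm_comp t σ hE hW hδ i b a hψ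
    -- `h : EW.symm a = (EE.symm b).comp i`
    have hEW : EW.symm a = ι := EW.symm_apply_apply ι
    rw [hEW] at h
    exact h.symm
  -- (7) the kernel dichotomy
  let K : Submodule ℂ XE := LinearMap.ker Φ.toLinearMap
  have hKinv : ∀ g, K ≤ K.comap (ρE g) := fun g x hx => by
    simp only [Submodule.mem_comap, K, LinearMap.mem_ker, IntertwiningMap.toLinearMap_apply] at hx ⊢
    rw [Φ.isIntertwining, hx, map_zero]
  have hKi : ∀ x ∈ K, ∀ w, i w = x → x = 0 := fun x hx w hw => by
    have h0 : ι w = 0 := by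
      have := congrArg (fun T : ρW.IntertwiningMap _ => T w) hΦi
      simp only [IntertwiningMap.comp] at this
      change Φ (i w) = ι w at this
      rw [← this, hw]
      exact hx
    have hw0 : w = 0 := hι (by rw [h0, map_zero])
    rw [← hw, hw0, map_zero]
  by_cases hK : K = ⊥
  · -- `Φ` injective: second alternative
    refine Or.inr ⟨Φ, ?_, hΦi⟩
    exact LinearMap.ker_eq_bot.1 hK
  · -- `p|_K` is a `G`-isomorphism onto the irreducible `V`: a section
    refine Or.inl ?_
    -- `p|_K` injective
    let q : K →ₗ[ℂ] XV := p.toLinearMap.domRestrict K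
    have hqinj : Injective q := by
      intro x y hxy
      apply Subtype.ext
      have hxy' : p (x.1 - y.1) = 0 := by
        rw [map_sub]; exact sub_eq_zero.2 hxy
      have hmem : x.1 - y.1 ∈ LinearMap.ker p.toLinearMap := hxy'
      rw [hex] at hmem
      obtain ⟨w, hw⟩ := hmem
      exact sub_eq_zero.1 (hKi _ (K.sub_mem x.2 y.2) w hw)
    -- the image `p(K)` is `G`-stable and non-zero, hence `⊤`
    let S : Submodule ℂ XV := K.map p.toLinearMap
    have hSinv : ∀ g, S ≤ S.comap (ρV g) := fun g v hv => by
      obtain ⟨x, hxK, rfl⟩ := hv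
      refine ⟨ρE g x, hKinv g hxK, ?_⟩
      change p (ρE g x) = ρV g (p x)
      exact IntertwiningMap.isIntertwining _ _ p g x
    have hS : S = ⊤ := by
      rcases hVirr S hSinv with h | h
      · exfalso
        apply hK
        rw [eq_bot_iff]
        intro x hx
        have : p x ∈ S := ⟨x, hx, rfl⟩
        rw [h, Submodule.mem_bot] at this
        have hq0 : q ⟨x, hx⟩ = 0 := this
        have := hqinj (hq0.trans (map_zero q).symm)
        rw [Submodule.mem_bot]
        exact congrArg Subtype.val this
      · exact h
    have hqsurj : Surjective q := fun v => by
      have hv : v ∈ S := by rw [hS]; exact Submodule.mem_top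
      obtain ⟨x, hx, rfl⟩ := hv
      exact ⟨⟨x, hx⟩, rfl⟩
    let e : K ≃ₗ[ℂ] XV := LinearEquiv.ofBijective q ⟨hqinj, hqsurj⟩
    have heq : ∀ x : K, e x = p x.1 := fun x => rfl
    -- the section `s := subtype ∘ e⁻¹`
    refine ⟨⟨K.subtype ∘ₗ (e.symm : XV →ₗ[ℂ] K), fun g => ?_⟩, ?_⟩
    · apply LinearMap.ext
      intro v
      obtain ⟨x, rfl⟩ := e.surjective v
      simp only [LinearMap.coe_comp, Function.comp_apply, LinearEquiv.coe_coe, LinearEquiv.symm_apply_apply, Submodule.coe_subtype]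
      have hx' : e ⟨ρE g x.1, hKinv g x.2⟩ = ρV g (e x) := by
        rw [heq, heq]
        exact IntertwiningMap.isIntertwining _ _ p g x.1
      rw [← hx', LinearEquiv.symm_apply_apply]
    · apply IntertwiningMap.ext
      apply LinearMap.ext
      intro v
      obtain ⟨x, rfl⟩ := e.surjective v
      change p ((K.subtype ∘ₗ (e.symm : XV →ₗ[ℂ] K)) (e x)) = e x
      simp only [LinearMap.coe_comp, Function.comp_apply, LinearEquiv.coe_coe, LinearEquiv.symm_apply_apply, Submodule.coe_subtype]
      exact (heq x).symm

end Sep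

end Representation

end
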